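import Literature.NumberTheory.EllipticCurves.AnticyclotomicSignedCompactSelmer
import HarnessLib

/-!
# The signed (plus/minus) condition at the BASE LAYER is the classical Kummer condition:
# Hatley–Lei–Vigni's `ℋ^±_{0,v}[p^m] = E(K_v)/p^m E(K_v)` (proof of Lemma 3.7; B.-D. Kim 2007
# Prop. 3.16) as a named fact on the tree's carrier `AcSigned.condAboveTorsion … (sgn ε) 0 m`, with the
# easy inclusion PROVED and the tree's global Lemma 3.7 DERIVED from it

Topic `Literature/NumberTheory/EllipticCurves`; namespace `Literature.NumberTheory.EllipticCurves.AcSigned`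
(continuing `AnticyclotomicSignedSelmer.lean` / `AnticyclotomicSignedCompactSelmer.lean`: `Setting`,
`signedKummerInfty`, `condAbove`, `toInfty`, `condAboveTorsion`, `selmerTorsion`,
`hatleyLeiVigni2022_lemma37_signedSelmerTorsion_zero`). Cell `pub/bsd-ssimc` (BSD summit), LEAD seat
`bsd-line-sbc-p1` (gen 29) acting on director-bsd ruling (507) «type it yourself», `--supports`
stmt-BirchSwinnertonDyer-20727 = crux `AnticyclotomicEisensteinDivisibility` of the route
`SignedBaseChange`, line `admdef`. HONEST FRAMING: ONE statement-only named fact (`def … : Prop`,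
D-0014; hypotheses as printed, specialised as documented; nothing asserted, no `_holds`) and NOTHING
else; the PROVED companions (the easy inclusion, unconditionally; the tree's global Lemma 3.7 fact as a
COROLLARY of the local one; sign-independence at layer `0`) are the sibling file
`AnticyclotomicSignedLayerZeroControlProofs.lean`. No new carrier, no instance, no notation. Typed ≠ proved ≠ endorsed; BSD is not advanced
by this file; the crux stays open.

## Why (the consumer, by name)

The line's "rigidity road" (`Summits/…/Theorems/SignedBaseChangeAnticyclotomicEisensteinDivisibility
AdmdefHowardVanishing.lean`, `…AdmdefHowardRigidityRoot(AllRamified).lean`: Howard 2006 Thm. 3.2.3 (c)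
at the root mod `𝔪` for the signed bipartite Euler systems of Castella–Hsu–Kundu–Lee–Liu 2025 §7.2)
carries exactly ONE non-tree input, the hypothesis
  (CTRL) for every `v ∣ p` and every `X ∈ H¹(K, E[p])`: if the transport of `X` to `H¹(Γ_{K_0}, E[p])`
         satisfies the layer-`0` signed condition `condAboveTorsion (W⁄K) p κ v (sgn ε) 0 1`, then `X`
         satisfies the Kummer condition at `K_v` (`selmerLocalKer`).
The tree types Hatley–Lei–Vigni's Lemma 3.7 GLOBALLY (`hatleyLeiVigni2022_lemma37_signedSelmerTorsion_zero`:
`Sel^±_{p^m}(E/K) = Sel_{p^m}(E/K)`), which does not yield (CTRL): (CTRL) is applied to classes that are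
NOT Selmer classes (ordinary at auxiliary primes, ramified at a Čebotarev prime). What the proof of
Lemma 3.7 PRINTS is the LOCAL identity of conditions at each `v ∣ p`, and that is what is typed here;
the easy half of it (`Kummer ⟹ signed`) is proved in the sibling `…Proofs` file for the tree's
carriers, so the content of the fact is the reverse inclusion.

## Sources, VERBATIM (texts read by this seat 2026-08-30; locators = files of the held texts)

* [HatleyLeiVigni2022] J. Hatley, A. Lei, S. Vigni, *`Λ`-submodules of finite index of anticyclotomic
  plus and minus Selmer groups of elliptic curves*, Manuscripta Math. 167 (2022) 589–612, author TeX
  `paper:arxiv-2003.10301`. §1.1 (standing): "`p` will denote an odd prime number. Let `E/ℚ` be an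
  elliptic curve of conductor `N` with good supersingular reduction at `p` and `a_p(E) = 0` … `K` an
  imaginary quadratic field such that all the primes dividing `pN` split in `K` … the two primes of `K`
  above `p` are totally ramified in `K_∞`; this … holds if `p` does not divide the class number of `K`".
  §3.1 [p0007 L24–L34]: "Let `v ∈ {𝔭, 𝔭^c}`. Following [Kim07], we define (3.1)
  `ℋ^±_v := ⋃_{n ≥ 0} Ê^±(K_{n,v}) ⊗ ℚ_p/ℤ_p`. For `n ∈ ℕ`, we also set
  `ℋ^±_{n,v} := (ℋ^±_v)^{Gal(K_{∞,v}/K_{n,v})}`." **Remark 3.1** [p0007 L36–L47]: "Using the Kummer map and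
  the fact … that the natural maps `H¹(K_n, E[p^∞]) → H¹(K_{∞,v}, E[p^∞])^{𝒢_{∞/n}}` and
  `H¹(K_{n,v}, E[p^m]) → H¹(K_{n,v}, E[p^∞])[p^m]` are isomorphisms, we may identify `ℋ^±_v` as a
  `Λ`-submodule of `H¹(K_{∞,v}, A)` … In turn, we may identify `ℋ^±_{n,v}` and `ℋ^±_{n,v}[p^m]` as
  submodules of `H¹(K_{n,v}, A)` and `H¹(K_{n,v}, A_m)`, respectively." **Prop. 3.2** [p0007 L51–L60]:
  "(a) The `Λ`-module `(ℋ^±_v)^∨` is free of rank one. (b) … the exact annihilator of `ℋ^±_{n,v}[p^m]`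
  is `ℋ^±_{n,v}[p^m]`. *Proof.* Part (a) is [Kim07] when the sign is `−`. This has been subsequently
  generalized to the `+` case in [Kim14], as our ground field is `ℚ_p`." **Def. 3.4** (the local
  condition `H¹(K_{n,v}, A_m)/ℋ^±_{n,v}[p^m]` at `v ∣ p`, `H¹(K_{n,v}, A_m)/(E(K_{n,v})/p^m)` at
  `v ∤ p`). **Lemma 3.7** [p0007 L105–L114]: "For all `m ∈ ℕ ∪ {∞}`, there is an equality
  `Sel^±_{p^m}(E/K) = Sel_{p^m}(E/K)`. *Proof.* In light of Remark 3.1, it suffices to show that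
  **`ℋ^±_{0,v}[p^m]` coincides with the image of `E(K_v)/p^m E(K_v)` in `H¹(K_v, A_m)` under the
  Kummer map.** Indeed, `ℋ^±_{0,v}[p^m]`, `E(K_v)/p^m E(K_v)` and `H¹(K_v, A_m)/(E(K_v)/p^m E(K_v))`
  are all free of rank one over `ℤ/p^m ℤ`. On the other hand, `E(K_v)/p^m E(K_v)` is contained in
  `ℋ^±_{0,v}[p^m]`, as explained in the proof of [Kim07], and the result follows." — THE SENTENCE TYPED
  HERE is the bold one.
* [BDKim2007] B. D. Kim, *The parity conjecture for elliptic curves at supersingular reduction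
  primes*, Compos. Math. 143 (2007) 47–72, `paper:doi-10-1112-s0010437x06002569`. §3.4 [p0011 L60–L93]
  "We assume that `L_∞` is a `ℤ_p`-extension of `ℚ_p` … only ramified … there is `L_N` such that
  `L_N/ℚ_p` is unramified and `L_∞/L_N` is totally ramified. … `H⁻ = Ê⁻(𝔪_{k_∞}) ⊗ ℚ_p/ℤ_p` …
  `Ê(𝔪_N) ⊗ ℚ_p/ℤ_p ⊂ (H⁻)^{Gal(L_∞/L_N)}`. By comparing the coranks and considering they are
  divisible we can see that `(H⁻)^{Gal(L_∞/L_N)} = Ê(𝔪_N) ⊗ ℚ_p/ℤ_p`. … **Proposition 3.16.** We have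
  `(H⁻)^{Gal(L_∞/ℚ_p)} = Ê(𝔪) ⊗ ℚ_p/ℤ_p`" (the minus-sign statement at the base of ANY ramified
  `ℤ_p`-extension of `ℚ_p`); p. 71 [p0025 L23–L25] (proof of Prop. 4.28, the anticyclotomic `K`):
  "The kernel of `H¹(K_𝔭, A)/E(K_𝔭) ⊗ ℚ_p/ℤ_p → ⊕_i H¹(K_{∞,Q_i}, A)/H_𝔭` is `(H_𝔭)^Γ/E(K_𝔭) ⊗ ℚ_p/ℤ_p`.
  It is `0`, since `(H_𝔭)^Γ ≅ ℚ_p/ℤ_p` and `E(K_𝔭) ⊗ ℚ_p/ℤ_p` is divisible and of corank `1`."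
  NOTE (locator hygiene): [BDKim2007] **Prop. 4.18** [p0019 L127] — "The kernel and cokernel of
  `f_F : H¹_F(K, A_{P_n}) → H¹_F(K, Hom(Λ, A))[P_n^ι]` are finite and bounded as `n` varies" — is the
  CONTROL AT HEIGHT-ONE PRIMES used by Castella–Wan Lemma 6.5; it is NOT the base-layer identity typed
  here (earlier memos of the consumer line mis-cited it for (CTRL); corrected here).
* [BDKim2013] B. D. Kim, J. Aust. Math. Soc. 95 (2013): Prop. 3.2 (p. 193) "`E(F_{n,v})` is
  `p`-torsion-free … `A^{G_{F_{∞,v}}} = 0`" (the input of Remark 3.1's isomorphisms; typed as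
  `AcSigned.bdKim2013_prop32_localPoints_noPTorsion`), Def. 3.3/3.5 (the `K_∞`-level condition `H^±_w`).

presearch: «`ℋ^±_{0,v}[p^m] = E(K_v)/p^m`» → [corpus: paper:arxiv-2003.10301 p0007 L113] the sentence
itself (HLV Lemma 3.7 proof); [corpus: paper:doi-10-1112-s0010437x06002569 p0011 Prop. 3.16, p0025]
the minus-sign invariants statement and its use; `lit search --hybrid "plus/minus Selmer finite layer
Kummer condition supersingular"` → no further held source; galaxy `"plus/minus Selmer|signed Selmer
group|Prop. 4.18" --star all` → 0 relevant rows. Tree search (`condAboveTorsion`, `lemma37`, `Kim`):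
the GLOBAL Lemma 3.7 and the local CARDINALITY `hatleyLeiVigni2022_lemma38_card_localCondTorsion` are
typed; the local IDENTITY of conditions is not — no restatement.

## What is typed, precisely (and the reading it carries)

For `c ∈ H¹(K_0, E[p^m]) = torsionH1Over (p^m) (κ.layerSubgroup 0)` (`κ.layerSubgroup 0 = Γ_K`):
  `c ∈ condAboveTorsion (W⁄K) p κ v (sgn ε) 0 m`  [the tree's `ℋ^ε_{0,v}[p^m]`-condition at every place
  above `v`: every `Γ_K`-conjugate of `θ_{0,m} c ∈ H¹(K_∞, E[p^∞])` restricts on `Gal(K̄_v/K_∞·K_v)` to a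
  Kummer class of `E^ε(K_∞·K_v) ⊗ ℚ_p/ℤ_p` — HLV's `ℋ^±_{0,v}[p^m] ⊂ H¹(K_v, A_m)` read through the
  identifications of Remark 3.1, which is how `condAboveTorsion` is DEFINED (pullback to `K_∞`)]
  ⟺ for every `σ ∈ Γ_K`, `conj_σ c` dies in `H¹(Gal(K̄_v/K_v), E(K̄_v))` [the classical Kummer
  condition "`loc_v c ∈` image of `E(K_v)/p^m E(K_v)`" at every place above `v` — VERBATIM the
  `v`-component of the tree's classical `WeierstrassCurve.selmerTorsionOver` and of `awayTorsionOver`].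
So the fact is the printed equality of two subgroups of `H¹(K_v, A_m)` PULLED BACK along `loc_v` to
`H¹(K, A_m)` (weaker than or equal to print, never stronger), for every `m : ℕ` (print: `m ∈ ℕ ∪ {∞}`;
TODO(general form): `m = ∞` on the discrete carriers) and both signs, under the `Setting` (Hatley–Lei–
Vigni's standing hypotheses specialised as in the sibling facts: `p` odd, good supersingular, `a_p = 0`,
`K` imaginary quadratic, `p = 𝔭𝔭'` split, `κ` anticyclotomic, `p ∤ h_K` for "totally ramified") and
their (Heeg) in the form the global fact carries it (`SatisfiesHeegnerHypothesis N K`, `N = N_E`).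
Flags inherited from the carriers (module docstrings of the two sibling files): `CW24-local-condition`,
`HLV (3.1)` (formal-group points `Ê^±` vs the tree's `E^ε`, the same groups after `⊗ ℚ_p/ℤ_p` at a
supersingular `v`), `tot-ram-via-h_K`.

Here: `hatleyLeiVigni2022_lemma37_local_signedCondition_eq_kummer` — the NAMED FACT (statement only).
In `…LayerZeroControlProofs.lean` (PROVED): `kummer_le_condAboveTorsion_sgn_zero` (for every number
field `K`, curve `W/K`, `κ`, `v`, `ε`, `m`: the classical condition at the places above `v` IMPLIES the
layer-`0` signed condition — "`E(K_v)/p^m E(K_v)` is contained in `ℋ^±_{0,v}[p^m]`", no trace condition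
at the bottom layer); `lemma37_signedSelmerTorsion_zero_of_local` (the local fact implies the tree's
global fact `hatleyLeiVigni2022_lemma37_signedSelmerTorsion_zero`: both Selmer groups are the
intersection of the SAME away-from-`p` conditions with the respective conditions above `p` — the
consistency of the two transcriptions, and the precise sense in which the local one is stronger).

## NOT in this file (and why)

* The local-carrier form "`localCondTorsion ((W⁄K)_{K_v}) p (κ.localize …) ε 0 m` = Kummer image of
  `E(K_v)/p^m`" on the LOCAL objects of `AnticyclotomicSignedLocalConditions.lean`: it needs the bridge
  `condAboveTorsion` (global curve, `closureEmb`, `⨅` over `Γ_K`) ↔ `localCondTorsion` (local curve,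
  `id`, `⨅` over `Γ_{K_v}`) — transport of `localKummerOverOfEmb` along `W ↦ W_{K_v}` — not in the tree.
* A PROOF of the fact from typed inputs: `hatleyLeiVigni2022_prop32a_localSignedDual_free_rank_one`
  (`(ℋ^±_v)^∨ ≅ Λ` ⟹ `(ℋ^±_v)^Γ ≅ ℚ_p/ℤ_p`) + `E(K_v) ⊗ ℚ_p/ℤ_p ≅ ℚ_p/ℤ_p` (structure of `E(ℚ_p)`) +
  `bdKim2013_prop32_localPoints_noPTorsion` (Remark 3.1's injectivities) + the bridge above: Kim's
  argument "comparing the coranks and considering they are divisible"; typer-scale, recorded as the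
  discharge road.
* Finite layers `n ≥ 1`: NO such identity holds there (HLV Remark 3.5: "`ℋ^±_{n,v}[p^m]` and
  `E(K_{n,v})/p^m` are both maximal isotropic … neither contains the other"); nothing is stated for `n ≥ 1`.
-/

noncomputable section

open scoped Classical

open NumberField IsDedekindDomain Field
open Literature.NumberTheory.EllipticCurves Literature.NumberTheory.GaloisRepresentations
open Literature.NumberTheory.EllipticCurves.Kobayashi2003
open WeierstrassCurve (geomTorsion)

universe u

namespace Literature.NumberTheory.EllipticCurves.AcSigned

/-! ## The named fact (statement only; the easy inclusion and the derivation of the global Lemma 3.7 are PROVED in the sibling `…LayerZeroControlProofs.lean`) -/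

section Facts

variable (W : WeierstrassCurve ℚ) [W.IsGloballyMinimal] (K : Type) [Field K] [NumberField K]
  (p : ℕ) [Fact p.Prime] (κ : ZpExtension K p) (𝔭 𝔭' : HeightOneSpectrum (𝓞 K))

/-- **Hatley–Lei–Vigni 2022, proof of Lemma 3.7 (after B.-D. Kim 2007, Prop. 3.16): at the base layer
`K_0 = K` the signed condition above `p` IS the classical Kummer condition — "`ℋ^±_{0,v}[p^m]` coincides
with the image of `E(K_v)/p^m E(K_v)` in `H¹(K_v, A_m)` under the Kummer map".** Printed proof:
"`ℋ^±_{0,v}[p^m]`, `E(K_v)/p^m E(K_v)` and `H¹(K_v, A_m)/(E(K_v)/p^m E(K_v))` are all free of rank one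
over `ℤ/p^m ℤ`. On the other hand, `E(K_v)/p^m E(K_v)` is contained in `ℋ^±_{0,v}[p^m]`, as explained
in the proof of [Kim07]"; B.-D. Kim 2007 Prop. 3.16: "`(H⁻)^{Gal(L_∞/ℚ_p)} = Ê(𝔪) ⊗ ℚ_p/ℤ_p`" for any
ramified `ℤ_p`-extension `L_∞/ℚ_p` (minus sign; plus sign [Kim14], ground field `ℚ_p`), used in the
anticyclotomic setting on p. 71 ("`(H_𝔭)^Γ ≅ ℚ_p/ℤ_p` and `E(K_𝔭) ⊗ ℚ_p/ℤ_p` is divisible and of corank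
`1`"). Standing hypotheses (HLV §1.1–1.2): `p` odd, `E/ℚ` of conductor `N` with good supersingular
reduction at `p` and `a_p(E) = 0`, `K` imaginary quadratic with (Heeg) "all the primes dividing `pN`
split in `K`", the primes above `p` totally ramified in `K_∞/K` (here via `p ∤ h_K`, `AcSigned.Setting`)
— EXACTLY the hypotheses of the sibling global fact `hatleyLeiVigni2022_lemma37_signedSelmerTorsion_zero`.
TRANSCRIBED for finite `m` (TODO(general form): `m = ∞`), at every `v ∣ p` and for both signs, on the
tree's objects and READ through HLV Remark 3.1 exactly as the carrier `condAboveTorsion` is defined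
(module docstring): the layer-`0` signed condition `condAboveTorsion (W⁄K) p κ v (sgn ε) 0 m ≤
H¹(K_0, E[p^m])` EQUALS the classical condition "every `Γ_K`-conjugate dies in `H¹(Gal(K̄_v/K_v),
E(K̄_v))`" (the `v`-component of `WeierstrassCurve.selmerTorsionOver (κ.layerSubgroup 0) (p^m)`), i.e.
the printed equality of subgroups of `H¹(K_v, A_m)` pulled back along `loc_v` (weaker than or equal to
print). The inclusion `⊇` is PROVED unconditionally (`kummer_le_condAboveTorsion_sgn_zero`, sibling `…Proofs`
file); the tree's global Lemma 3.7 follows from this fact (`lemma37_signedSelmerTorsion_zero_of_local`,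
ibid.). NOT B.-D. Kim 2007 Prop. 4.18 (that is the control at height-one primes `f_F`, Castella–Wan
Lemma 6.5).
[cite: HatleyLeiVigni2022, Lemma 3.7 (proof), Remark 3.1, (3.1), Def. 3.4 and §1.1–1.2]
[cite: BDKim2007, Prop. 3.16 (§3.4) and proof of Prop. 4.28 (p. 71)] -/
def hatleyLeiVigni2022_lemma37_local_signedCondition_eq_kummer : Prop :=
  ∀ (_ : Setting W K p κ 𝔭 𝔭') (N : ℕ), (W.conductorNorm ℤ : ℕ) = N → SatisfiesHeegnerHypothesis N K →
    ∀ (v : HeightOneSpectrum (𝓞 K)), ((p : ℕ) : 𝓞 K) ∈ v.asIdeal → ∀ (ε : ℤˣ) (m : ℕ),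
      condAboveTorsion (W.baseChange K) p κ v (.sgn ε) 0 m =
        ⨅ σ : absoluteGaloisGroup K,
          (((W.baseChange K).localResTorsionOverOfEmb ((p : ℤ) ^ m) (κ.layerSubgroup 0)
              (closureEmb (K := K) (v.adicCompletion K))).ker).comap
            (conjH1 (κ.layerSubgroup 0) (geomTorsion (W.baseChange K) ((p : ℤ) ^ m)) σ)

end Facts

end Literature.NumberTheory.EllipticCurves.AcSigned

end
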